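import Summits.BirchSwinnertonDyer.Rank1Residual.X5.SelmerSolitaireExtend
import HarnessLib

/-!
# Selmer solitaire: matrix–vector products of a one-vertex extension (support for (R2) of T4′)

Cell `b2b-bsdres`, O1 (p = 2) PROVER ORDER v2.8 (ii′) (x11b3-p4; `HOME/b2b-bsdres-x11b3-p4/T4PRIME-PLAN.md`
item (R2)).  Pure 𝔽₂ linear algebra on x11b3-p2's `extend` (`X5/SelmerSolitaireExtend.lean`); theorems only;
reach-neutral; nothing booked; O1 OPEN.

* `sum_V_succ` — a sum over the vertices of the extended graph = the new vertex + the old vertices.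
* `extend_mulVec_oldV`, `extend_mulVec_new` — the two blocks of `Ŝ' x'` for `Ŝ' = extend P N`:
  `(Ŝ'x')(v̄) = (Ŝ x)(v) + N(v)·x'(q)` and `(Ŝ'x')(q) = ∑_v N(v) x(v)`, `x = x' ∘ oldV`.

[cite: MazurRubin2004, §4.3]
-/

namespace Summit.BirchSwinnertonDyer.Rank1Residual.X5.SelmerSolitaire

open Finset Matrix

variable {s : ℕ} {R : Type*} [AddCommMonoid R]

/-- **Splitting a sum over `V (s+1)`** into the new vertex `q = some (Fin.last s)` and the old vertices
`oldV v`. [folklore] -/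
theorem sum_V_succ (f : V (s + 1) → R) :
    ∑ w, f w = f (some (Fin.last s)) + ∑ v : V s, f (oldV v) := by
  rw [← Fintype.sum_equiv unNew.symm (fun o => f (unNew.symm o)) f (fun o => rfl), Fintype.sum_option,
    unNew_symm_none]
  simp only [unNew_symm_some]

/-- **Old rows of `Ŝ' x'`**: `(Ŝ' x')(oldV v) = (Ŝ (x' ∘ oldV))(v) + N v · x'(q)`. [folklore] -/
theorem extend_mulVec_oldV (P : Position s) (N : V s → ZMod 2) (x' : V (s + 1) → ZMod 2) (v : V s) :
    ((extend P N).S *ᵥ x') (oldV v) =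
      (P.S *ᵥ fun w => x' (oldV w)) v + N v * x' (some (Fin.last s)) := by
  simp only [Matrix.mulVec, dotProduct]
  rw [sum_V_succ, extend_S_oldV_new, add_comm]
  simp only [extend_S_oldV_oldV]

/-- **The new row of `Ŝ' x'`**: `(Ŝ' x')(q) = ∑_v N v · x'(oldV v)`. [folklore] -/
theorem extend_mulVec_new (P : Position s) (N : V s → ZMod 2) (x' : V (s + 1) → ZMod 2) :
    ((extend P N).S *ᵥ x') (some (Fin.last s)) = ∑ v : V s, N v * x' (oldV v) := by
  simp only [Matrix.mulVec, dotProduct]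
  rw [sum_V_succ, extend_S_new_new, zero_mul, zero_add]
  simp only [extend_S_new_oldV]

end Summit.BirchSwinnertonDyer.Rank1Residual.X5.SelmerSolitaire
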